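import Summits.AtomisticToContinuum.Crystallization.Theorems.PricedLinkCensusStackingHingeAllPointsOfRoot

/-!
# `StackingHinge` (stmt-AtomisticToContinuum-14993), line `Sketch`: stub `stub_allPointsOfRootBond`

Transfer, part (c), bond-shell version: EVERYTHING SHOWS AT THE ROOT.  For a point-stationary
hard-core probability law `P` on rooted configurations `μ = count|S`, `0 ∈ S` (Mecke /
mass-transport form), if the ROOT is bond-shell-good `P`-a.s. (no point of `S` in the gap
`[1.01 nn, 1.07 nn)` beyond `1.01 nn`, and twelve points of `S ∖ {0}` within `1.01 nn`, where
`nn` is the nearest-neighbour distance of the root) then `P`-a.s. EVERY point of the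
configuration is bond-shell-good.

Proof.  Identical to `stub_allPointsOfRoot` (SLP-goodness): hard-core configurations are locally
finite (`count_restrict_floorNorm_preimage_lt_top`), so the Aldous–Lyons lemma in Mecke form
(`ae_forall_map_sub_of_ae`) transports the a.s. root property to the configuration re-rooted at
every one of its points; the re-rooted configuration is `count|((· − x) '' S)`
(`map_sub_count_restrict`), counting measures determine their sets (`eq_of_count_restrict_eq`),
and bond-shell goodness is invariant under the translation `z ↦ z − x`: the nearest-neighbour
distance is unchanged (`infDist_zero_image_sub`), distances to the root transport by
`dist_sub_right`, and a twelve-point shell `T'` of the translate is carried back to the shell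
`T'.map (· + x)` of `S` about `x`.  All `[folklore]`.
-/

noncomputable section

namespace Summit.AtomisticToContinuum.Crystallization.Theorems.PricedHcpWindowsAllPointsOfRootBond

open MeasureTheory Set Literature.Probability.Process
open Summit.AtomisticToContinuum.Crystallization.Theorems.PalmUnimodularRigidity
  (ae_forall_map_sub_of_ae count_restrict_floorNorm_preimage_lt_top)
open Summit.AtomisticToContinuum.Crystallization.Theorems.PricedHcpWindowsAllPointsOfRoot
  (eq_of_count_restrict_eq infDist_zero_image_sub)

/-! ## Translation covariance of the bond-shell predicate -/

section Translate

variable {E : Type*} [NormedAddCommGroup E]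

/-- The distance from the origin to the translate `y − x` is the distance from `x` to `y`.
[folklore] -/
theorem dist_zero_sub_eq_dist (x y : E) : dist (0 : E) (y - x) = dist x y := by
  rw [← dist_sub_right x y x, sub_self]

/-- **Gap clause is translation covariant.**  If no point of the translate `S − x` other than the
origin lies at distance in `[a-gap)` from the origin — precisely: every `y' ∈ S − x`, `y' ≠ 0`, with
`dist 0 y' < a` has `dist 0 y' ≤ b` — then every `y ∈ S`, `y ≠ x`, with `dist x y < a` has
`dist x y ≤ b`. [folklore] -/
theorem gap_of_image_sub {S : Set E} {x : E} {a b : ℝ}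
    (h : ∀ y ∈ (fun z : E => z - x) '' S, y ≠ 0 → dist (0 : E) y < a → dist (0 : E) y ≤ b) :
    ∀ y ∈ S, y ≠ x → dist x y < a → dist x y ≤ b := by
  intro y hy hyx hlt
  have h0 : y - x ≠ 0 := fun h0 => hyx (sub_eq_zero.1 h0)
  have h' := h (y - x) (Set.mem_image_of_mem _ hy) h0
  rw [dist_zero_sub_eq_dist] at h'
  exact h' hlt

/-- **Twelve-shell clause is translation covariant.**  A twelve-point subset of the punctured
`b`-ball about the origin in the translate `S − x` translates back (by `· + x`) to a twelve-point
subset of the punctured `b`-ball about `x` in `S`. [folklore] -/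
theorem twelve_of_image_sub {S : Set E} {x : E} {b : ℝ}
    (h : ∃ T : Finset E,
      (↑T : Set E) ⊆ {y : E | y ∈ (fun z : E => z - x) '' S ∧ y ≠ 0 ∧ dist (0 : E) y ≤ b} ∧
        T.card = 12) :
    ∃ T : Finset E, (↑T : Set E) ⊆ {y : E | y ∈ S ∧ y ≠ x ∧ dist x y ≤ b} ∧ T.card = 12 := by
  obtain ⟨T, hT, hcard⟩ := h
  refine ⟨T.map (addRightEmbedding x), fun y hy => ?_, by rw [Finset.card_map, hcard]⟩
  rw [Finset.coe_map] at hy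
  obtain ⟨y', hy', rfl⟩ := hy
  obtain ⟨⟨z, hz, rfl⟩, hz0, hdist⟩ := hT (Finset.mem_coe.2 hy')
  rw [addRightEmbedding_apply, sub_add_cancel]
  rw [dist_zero_sub_eq_dist] at hdist
  exact ⟨hz, fun hzx => hz0 (show z - x = 0 by rw [hzx, sub_self]), hdist⟩

end Translate

/-! ## The stub -/

/-- **stub_allPointsOfRootBond** (transfer, part c, bond-shell version: EVERYTHING SHOWS AT THE
ROOT).  For a point-stationary hard-core probability law `P` (Mecke / mass-transport form), if
a.s. the root is bond-shell-good then a.s. EVERY point is bond-shell-good: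
`ae_forall_map_sub_of_ae` (Aldous–Lyons Lemma 2.3 in Mecke form; local finiteness from the hard
core by `count_restrict_floorNorm_preimage_lt_top`), the re-rooting identity
`map_sub_count_restrict` (`θ_x count|S = count|((· − x) '' S)`), injectivity of `S ↦ count|S`
(`eq_of_count_restrict_eq`), and translation covariance of bond-shell goodness
(`infDist_zero_image_sub`, `gap_of_image_sub`, `twelve_of_image_sub`). [folklore] -/
theorem stub_allPointsOfRootBond : ∀ δ : ℝ, 0 < δ → ∀ P : MeasureTheory.Measure (MeasureTheory.Measure (EuclideanSpace ℝ (Fin 3))), MeasureTheory.IsProbabilityMeasure P → (∀ᵐ μ ∂P, (∃ S : Set (EuclideanSpace ℝ (Fin 3)), (0 : EuclideanSpace ℝ (Fin 3)) ∈ S ∧ (∀ x ∈ S, ∀ y ∈ S, x ≠ y → δ ≤ dist x y) ∧ μ = (MeasureTheory.Measure.count : MeasureTheory.Measure (EuclideanSpace ℝ (Fin 3))).restrict S)) → (∀ g : MeasureTheory.Measure (EuclideanSpace ℝ (Fin 3)) → EuclideanSpace ℝ (Fin 3) → ENNReal, Measurable (Function.uncurry g) → ∫⁻ μ, ∫⁻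 y, g μ y ∂μ ∂P = ∫⁻ μ, ∫⁻ y, g (MeasureTheory.Measure.map (fun z => z - y) μ) (-y) ∂μ ∂P) → (∀ᵐ μ ∂P, ∃ S : Set (EuclideanSpace ℝ (Fin 3)), μ = (MeasureTheory.Measure.count : MeasureTheory.Measure (EuclideanSpace ℝ (Fin 3))).restrict S ∧ (0 : EuclideanSpace ℝ (Fin 3)) ∈ S ∧ ((∀ y ∈ S, y ≠ (0 : EuclideanSpace ℝ (Fin 3)) → dist (0 : EuclideanSpace ℝ (Fin 3)) y < 107 / 100 * Metric.infDist (0 : EuclideanSpace ℝ (Fin 3)) (S \ {(0 : EuclideanSpace ℝ (Fin 3))}) → dist (0 : EuclideanSpace ℝ (Fin 3)) y ≤ 101 / 100 * Metric.infDist (0 : EuclideanSpace ℝ (Fin 3)) (S \ {(0 : EuclideanSpace ℝ (Fin 3))})) ∧ ∃ T : Finset (EuclideanSpace ℝ (Fin 3)), (↑T : Set (EuclideanSpace ℝ (Fin 3))) ⊆ {y : EuclideanSpace ℝ (Fin 3) | y ∈ S ∧ y ≠ (0 : EuclideanSpace ℝ (Fin 3)) ∧ dist (0 : EuclideanSpace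 ℝ (Fin 3)) y ≤ 101 / 100 * Metric.infDist (0 : EuclideanSpace ℝ (Fin 3)) (S \ {(0 : EuclideanSpace ℝ (Fin 3))})} ∧ T.card = 12)) → (∀ᵐ μ ∂P, ∃ S : Set (EuclideanSpace ℝ (Fin 3)), μ = (MeasureTheory.Measure.count : MeasureTheory.Measure (EuclideanSpace ℝ (Fin 3))).restrict S ∧ ∀ x ∈ S, ((∀ y ∈ S, y ≠ x → dist x y < 107 / 100 * Metric.infDist x (S \ {x}) → dist x y ≤ 101 / 100 * Metric.infDist x (S \ {x})) ∧ ∃ T : Finset (EuclideanSpace ℝ (Fin 3)), (↑T : Set (EuclideanSpace ℝ (Fin 3))) ⊆ {y : EuclideanSpace ℝ (Fin 3) | y ∈ S ∧ y ≠ x ∧ dist x y ≤ 101 / 100 * Metric.infDist x (S \ {x})} ∧ T.card = 12)) := by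
  intro δ hδ P _hP hcore hstat hroot
  -- hard-core configurations are locally finite
  have hlf : ∀ᵐ μ ∂P, ∀ n : ℕ,
      μ ((fun z : EuclideanSpace ℝ (Fin 3) => ⌊‖z‖⌋₊) ⁻¹' {n}) < ⊤ := by
    filter_upwards [hcore] with μ hμ n
    obtain ⟨S, -, hsep, rfl⟩ := hμ
    exact count_restrict_floorNorm_preimage_lt_top hδ hsep n
  -- everything shows at the root: the re-rooted configuration has a bond-shell-good root, a.s.
  have hall := ae_forall_map_sub_of_ae hstat hlf hroot
  filter_upwards [hcore, hall] with μ hc ha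
  obtain ⟨S, -, -, rfl⟩ := hc
  refine ⟨S, rfl, fun x hx => ?_⟩
  obtain ⟨S', hS', -, hgap, htwelve⟩ := ha x ((count_restrict_singleton_ne_zero_iff S x).2 hx)
  -- the re-rooted configuration is the counting measure of the translated set
  rw [map_sub_count_restrict] at hS'
  obtain rfl := eq_of_count_restrict_eq hS'
  -- translation covariance of bond-shell goodness
  rw [infDist_zero_image_sub] at hgap htwelve
  exact ⟨gap_of_image_sub hgap, twelve_of_image_sub htwelve⟩

end Summit.AtomisticToContinuum.Crystallization.Theorems.PricedHcpWindowsAllPointsOfRootBond
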